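import Mathlib
import Literature.NumberTheory.Automorphic.HilbertModularFormQExpansion
import Literature.NumberTheory.Automorphic.CongruenceSubgroupPropertySL2Proofs

/-!
# `Γ₁(𝔪) = T(𝓞 F) · Γ(𝔪)`: translations times the principal congruence subgroup

Stub `stub_gamma1_decomposition` (N3) for line Sketch-ideate-r1-k1 of the crux
`HilbertIntegralOverconvergentIsCongruence` (stmt-Langlands-8485).  Section N of the line proves
"algebraic over Hilbert modular forms ⇒ modular": the abstract transfer gives the weight-`k` law of
`g` under a principal congruence subgroup `Γ(𝔪)`, and since `g` is invariant under all integral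
translations `z ↦ z + b` (`b ∈ 𝓞 F`) the law extends to `Γ₁(𝔪)` once every `γ ∈ Γ₁(𝔪)` is written
as `γ = (1 b; 0 1) γ'` with `γ' ∈ Γ(𝔪)` — this file.  Proof: for `γ = (a b; c d)` with `c ∈ 𝔪`,
`d - 1 ∈ 𝔪` take `b` the upper-right entry and `γ' = E₁₂(-b) γ = (a - bc, -b(d - 1); c, d)`; its
entries are `≡ (1 0; 0 1) (mod 𝔪)` because `a - bc - 1 = -a(d - 1)` (from `ad - bc = 1`).  The
elementary matrix `E₁₂` and the entrywise membership criterion for `Γ(𝔪) = ker (SL₂(R) → SL₂(R/𝔪))`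
are the tree's `SL2Rel.e12`, `SL2Rel.mem_Gamma` (file `CongruenceSubgroupPropertySL2Proofs.lean`).
-/

set_option linter.dupNamespace false

noncomputable section

namespace Summit.Langlands.Langlands.Theorems.HilbertIntegralOverconvergentIsCongruence

open NumberField
open Literature.NumberTheory.Automorphic
open scoped MatrixGroups

/-- For `γ = (a b; c d) ∈ SL₂(R)` with `c ∈ I` and `d - 1 ∈ I`, the matrix
`E₁₂(b)⁻¹ γ = (a - bc, -b(d - 1); c, d)` lies in the principal congruence subgroup `Γ(I)`
(as `a - bc - 1 = -a(d - 1)` by `ad - bc = 1`). -/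
theorem g1d_e12_inv_mul_mem_Gamma {R : Type*} [CommRing R] {I : Ideal R} (γ : SL(2, R))
    (hc : γ 1 0 ∈ I) (hd : γ 1 1 - 1 ∈ I) :
    (SL2Rel.e12 (γ 0 1))⁻¹ * γ ∈ Bianchi.Gamma I := by
  have hdet : γ 0 0 * γ 1 1 - γ 0 1 * γ 1 0 = 1 := by
    have h := γ.det_coe
    rw [Matrix.det_fin_two] at h
    exact h
  rw [← SL2Rel.e12_neg]
  refine SL2Rel.mem_Gamma.2 ⟨?_, ?_, ?_, ?_⟩
  · -- upper right: `b - b d = -(b (d - 1))`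
    rw [SL2Rel.mul_apply_two, SL2Rel.e12_apply_00, SL2Rel.e12_apply_01]
    have e : 1 * γ 0 1 + -γ 0 1 * γ 1 1 = -(γ 0 1 * (γ 1 1 - 1)) := by ring
    rw [e]
    exact I.neg_mem (I.mul_mem_left _ hd)
  · -- lower left: `c`
    rw [SL2Rel.mul_apply_two, SL2Rel.e12_apply_10, SL2Rel.e12_apply_11, zero_mul, zero_add, one_mul]
    exact hc
  · -- upper left: `a - b c - 1 = -(a (d - 1))`
    rw [SL2Rel.mul_apply_two, SL2Rel.e12_apply_00, SL2Rel.e12_apply_01]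
    have e : 1 * γ 0 0 + -γ 0 1 * γ 1 0 - 1 = -(γ 0 0 * (γ 1 1 - 1)) := by
      linear_combination hdet
    rw [e]
    exact I.neg_mem (I.mul_mem_left _ hd)
  · -- lower right: `d - 1`
    rw [SL2Rel.mul_apply_two, SL2Rel.e12_apply_10, SL2Rel.e12_apply_11, zero_mul, zero_add, one_mul]
    exact hd

/-- **Stub N3 (`stub_gamma1_decomposition`).** `Γ₁(𝔪) = T(𝓞 F) · Γ(𝔪)`: every element of
`Γ₁(𝔪)` is a translation `(1 b; 0 1)`, `b ∈ 𝓞 F`, times an element of the principal congruence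
subgroup `Γ(𝔪)` (take `b` = the upper-right entry: `(1 -b; 0 1)γ ≡ 1 (mod 𝔪)` because `d ≡ 1`,
`c ≡ 0`, `a ≡ ad - bc = 1`). -/
theorem stub_gamma1_decomposition (F : Type) [Field F] [NumberField F] (𝔪 : Ideal (𝓞 F)) (γ : SL(2, 𝓞 F))
    (hγ : γ ∈ Bianchi.Gamma1 𝔪) :
    ∃ (b : 𝓞 F) (t γ' : SL(2, 𝓞 F)), (t : Matrix (Fin 2) (Fin 2) (𝓞 F)) = !![1, b; 0, 1] ∧
      γ' ∈ Bianchi.Gamma 𝔪 ∧ γ = t * γ' :=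
  ⟨γ 0 1, SL2Rel.e12 (γ 0 1), (SL2Rel.e12 (γ 0 1))⁻¹ * γ, rfl,
    g1d_e12_inv_mul_mem_Gamma γ hγ.1 hγ.2, (mul_inv_cancel_left _ _).symm⟩

end Summit.Langlands.Langlands.Theorems.HilbertIntegralOverconvergentIsCongruence
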